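import Mathlib
import Literature.NumberTheory.LFunctions.Zhang2022.Section17U021ChiR1Composite
import Literature.NumberTheory.LFunctions.Zhang2022.Section17FrakACurrencyCounts
import HarnessLib

/-!
# Zhang (2022) §17.u021 (χ-twisted reading), remainder `R₁`, piece M2L-c (composite large arguments):
# the CLOSED form — the `𝔞`-currency count of record plugged in

Topic `Literature/NumberTheory/LFunctions/Zhang2022` (Landau–Siegel audit tree; verdict-neutral).
Y. Zhang, *Discrete mean estimates and the Landau–Siegel zero*, arXiv:2211.02515v1 (2022)
[Zhang2022LandauSiegel] — **an unrefereed manuscript under adjudication; nothing here asserts or denies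
its Theorems 1–2, and no claim about Landau–Siegel zeros is made.** ZHANG-L lane, WP16/§17, helper under
the leaf `Typed.Section17.Eq17_9RelE e1ppD` via the sub-leaf `R₁` of `Typed.Section17.Step17_u021Chi`
(§17 p. 98, tex L4825: "we can drop the terms with `m₂ > 1` … with an acceptable error" — no bound in
print). Companion of `Section17U021ChiR1Composite` (zl-w14-p2): there the composite large-argument range
of `R₁` (owner's cut M2L-c, relative currency) is bounded GIVEN an `𝔞`-currency count
`Σ_{l<D⁴}|ν(l)|τ₆(l)/l ≤ C(𝔞+1)³`; the count OF RECORD landed by the R₁ owner's A1 file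
(`Typed.Section17.sum_nu_tau6_div_le_frakA_cube_loglog`, `Section17FrakACurrencyCounts`) carries the
honest extra factor `(log 𝓛)⁶` (the pure `(𝔞+1)³` form is false at the lane's sizes, referee zl-libB-ref
03:19Z). This file re-runs the 100-line size assembly with that factor (margin `𝓛^{−1}(log 𝓛)⁶`, spent as
`(log 𝓛)⁶ ≤ 12⁶√𝓛`) and CLOSES the piece:

* `R1_composite_large_small_of_count_loglog (hcount : … ≤ C(𝔞+1)³(log 𝓛)⁶) : M2L-c`;
* **`R1_composite_large_small (c′)` — M2L-c, the hypothesis `hLc` of the R₁ assembly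
  `Phi3Eval.step17_u021Chi_R1Rel_of_split_rel` (zl-libB-p6, `Section17U021ChiR1Assembly`), with NO
  hypothesis left**: for every `ε > 0`, eventually in `D`, under (A),
  `Σ_{l<D⁴}|ν(l)|/l Σ_{l=l₁l₂} Σ'_{m₁} Σ'_{m₂ : D⁴<l₂m₂, 2≤m₂, m₂ not prime, (m₂,l₁)=1}
   |b(l₁m₁)||ν₁*(l₂m₂)||κ̄₂(m₁m₂)|/(m₁m₂) ≤ ε(𝔞+1)`.

Theorems only; no definitions; (A) is used (through the count and the relative currency), as ruled.

## References

* Y. Zhang, arXiv:2211.02515v1 (2022), §17 p. 98 (u021), tex L4825. [cite: Zhang2022LandauSiegel, §17 u021 p.98]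
-/

noncomputable section

open Complex Real ComplexConjugate ArithmeticFunction Finset
open scoped LSeries.notation

namespace Literature.NumberTheory.LFunctions.Zhang2022.Typed.Section17

open Literature.NumberTheory.LFunctions.Zhang2022
open Literature.NumberTheory.LFunctions.Zhang2022.Skeleton
open Literature.NumberTheory.LFunctions.Zhang2022.MeanSquareMajorant

section Closed

variable (c' : ℝ)

/-- Elementary: for `0 ≤ y ≤ 1`, `y(e^y − 1) ≤ 2y²` (`e^y − 1 ≤ 2y` on `[0,1]`). [folklore] -/
private theorem mul_exp_sub_one_le' {y : ℝ} (h0 : 0 ≤ y) (h1 : y ≤ 1) : y * (Real.exp y - 1) ≤ 2 * y ^ 2 := by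
  have h := Real.abs_exp_sub_one_le (x := y) (by rw [abs_of_nonneg h0]; exact h1)
  rw [abs_of_nonneg h0] at h
  have h' : Real.exp y - 1 ≤ 2 * y := le_trans (le_abs_self _) h
  calc y * (Real.exp y - 1) ≤ y * (2 * y) := mul_le_mul_of_nonneg_left h' h0
    _ = 2 * y ^ 2 := by ring

/-- **M2L-c, the composite large-argument range of `R₁`, fully summed, in the relative currency** —
GIVEN the `𝔞`-currency outer count in the shape OF RECORD `Σ_{l<D⁴}|ν(l)|τ₆(l)/l ≤ C(𝔞+1)³(log 𝓛)⁶`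
(piece A1b, `sum_nu_tau6_div_le_frakA_cube_loglog`; hypothesis `hcount`):
for every `ε > 0`, for all large `D`, under (A),
`Σ_{l<D⁴}|ν(l)|/l Σ_{l=l₁l₂}Σ_{m₁}Σ_{m₂: l₂m₂>D⁴, m₂≥2 composite, (m₂,l₁)=1}|b(l₁m₁)||ν₁*(l₂m₂)||κ̄₂(m₁m₂)|/(m₁m₂)
≤ ε(𝔞+1)`. Sizes: `|b₁| ≤ (1+5|c′|π)α`, `α = π𝓛⁻⁹`; composite `m₂` with two distinct primes carry the
double gain `Y(e^Y−1) ≤ 2Y² ≍ 𝓛^{−14}`, prime powers `p^k` (`k ≥ 2`) the single gain `≍ α`; the outer count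
costs `(𝔞+1)³` with `𝔞+1 ≤ (16e⁹+1)𝓛⁴` (`frakA_le_ell_pow_four'`), whence the total is
`≪ (log 𝓛)⁶𝓛⁻¹·(𝔞+1) ≤ 12⁶𝓛^{−1/2}(𝔞+1) ≤ ε(𝔞+1)`. The `m₁`-sum is zl-w11-p3's `m1Sum_le` (M1). [cite: Zhang2022LandauSiegel, §17 u021 p. 98] -/
theorem R1_composite_large_small_of_count_loglog
    (hcount : ∃ C : ℝ, ForAllLarge fun D _ χ => AssumptionA D χ →
      ∑ l ∈ Finset.Ico 1 (D ^ 4), ‖nu χ l‖ * tau 6 l / l ≤ C * (frakA χ + 1) ^ 3 * Real.log (ell D) ^ 6) :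
    ∀ ε : ℝ, 0 < ε → ForAllLarge fun D _ χ => AssumptionA D χ →
      ∑ l ∈ Finset.Ico 1 (D ^ 4), ‖nu χ l‖ / l * ∑ q ∈ l.divisorsAntidiagonal, ∑' m₁ : ℕ, ∑' m₂ : ℕ,
        (if (D : ℝ) ^ 4 < q.2 * m₂ ∧ 2 ≤ m₂ ∧ ¬ m₂.Prime ∧ Nat.Coprime m₂ q.1 then
          ‖bcoef D (q.1 * m₁)‖ * ‖nuOneStar c' χ (q.2 * m₂)‖ * ‖kappa2bar c' D (m₁ * m₂)‖ /
            ((m₁ : ℝ) * m₂) else 0) ≤ ε * (frakA χ + 1) := by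
  intro ε hε
  obtain ⟨CA, hCA⟩ := hcount
  obtain ⟨CM₀, hM⟩ := m1Sum_le c'
  obtain ⟨D₁, hD₁⟩ := hCA
  obtain ⟨D₂, hD₂⟩ := hM
  -- numerical constants (opaque names with their defining bounds)
  obtain ⟨C4, hC4⟩ : ∃ C : ℝ, ∑' i : ℕ, ((i : ℝ) + 2) ^ 4 * (1 / 2 : ℝ) ^ i ≤ C := ⟨_, le_rfl⟩
  obtain ⟨C4', hC4'⟩ : ∃ C : ℝ, ∑' i : ℕ, ((i : ℝ) + 3) ^ 4 * (1 / 2 : ℝ) ^ i ≤ C := ⟨_, le_rfl⟩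
  obtain ⟨C5, hC5⟩ : ∃ C : ℝ, ∑' n : ℕ, ((n : ℝ) ^ (3 / 2 : ℝ))⁻¹ ≤ C := ⟨_, le_rfl⟩
  have hC40 : 0 ≤ C4 := le_trans (tsum_nonneg fun i => by positivity) hC4
  have hC4'0 : 0 ≤ C4' := le_trans (tsum_nonneg fun i => by positivity) hC4'
  have hC50 : 0 ≤ C5 := le_trans (tsum_nonneg fun n => by positivity) hC5
  obtain ⟨CM, hCMge, hCM0⟩ : ∃ C : ℝ, CM₀ ≤ C ∧ 0 ≤ C := ⟨max CM₀ 0, le_max_left _ _, le_max_right _ _⟩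
  obtain ⟨CA', hCAge, hCA'0⟩ : ∃ C : ℝ, CA ≤ C ∧ 0 ≤ C := ⟨max CA 0, le_max_left _ _, le_max_right _ _⟩
  obtain ⟨Kb, hKb⟩ : ∃ K : ℝ, K = (1 + 5 * |c'| * π) * π := ⟨_, rfl⟩
  have hKb0 : 0 ≤ Kb := by rw [hKb]; positivity
  obtain ⟨KY, hKY⟩ : ∃ K : ℝ, K = 4 * C4 * Kb * 13 := ⟨_, rfl⟩
  have hKY0 : 0 ≤ KY := by rw [hKY]; positivity
  obtain ⟨KP, hKP⟩ : ∃ K : ℝ, K = 8 * C4' * C5 * Kb := ⟨_, rfl⟩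
  have hKP0 : 0 ≤ KP := by rw [hKP]; positivity
  obtain ⟨KA, hKA⟩ : ∃ K : ℝ, K = 16 * Real.exp 9 + 1 := ⟨_, rfl⟩
  have hKA0 : 0 ≤ KA := by rw [hKA]; positivity
  obtain ⟨K, hK⟩ : ∃ K₀ : ℝ, K₀ = CM * (2 * KY ^ 2 + KP) * CA' * KA ^ 2 := ⟨_, rfl⟩
  have hK0 : 0 ≤ K := by rw [hK]; positivity
  obtain ⟨D₃, hD₃⟩ := Section7Eq75.exists_nat_le_ell (max 3 (max (KY + 1) ((K * 12 ^ 6 / ε) ^ 2 + 1)))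
  refine ⟨max (max D₁ D₂) D₃, fun D _ χ hD hq hp hA => ?_⟩
  have hD1 : D₁ ≤ D := le_trans (le_trans (le_max_left _ _) (le_max_left _ _)) hD
  have hD2 : D₂ ≤ D := le_trans (le_trans (le_max_right _ _) (le_max_left _ _)) hD
  have hD3 : D₃ ≤ D := le_trans (le_max_right _ _) hD
  have hℓbig := hD₃ D hD3
  have hℓ3 : 3 ≤ ell D := le_trans (le_max_left _ _) hℓbig
  have hℓY : KY + 1 ≤ ell D := le_trans (le_trans (le_max_left _ _) (le_max_right _ _)) hℓbig
  have hℓK : (K * 12 ^ 6 / ε) ^ 2 + 1 ≤ ell D := le_trans (le_trans (le_max_right _ _) (le_max_right _ _)) hℓbig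
  have hℓ1 : 1 ≤ ell D := by linarith
  have hℓ0 : 0 < ell D := by linarith
  have hlog1 : 1 ≤ Real.log D := by rw [← ell]; exact hℓ1
  -- M1 with the nonnegative constant
  have hM1 : ∀ q₁ m₂ : ℕ, 1 ≤ q₁ → 1 ≤ m₂ →
      (∑' m₁ : ℕ, ‖bcoef D (q₁ * m₁)‖ * ‖kappa2bar c' D (m₁ * m₂)‖ / (m₁ : ℝ)) ≤
        CM * (q₁.divisors.card : ℝ) * ‖kappa2bar c' D m₂‖ * ((m₂ : ℝ) / m₂.totient) ^ 2 := by
    intro q₁ m₂ hq₁ hm₂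
    refine (hD₂ D χ hD2 hq hp q₁ m₂ hq₁ hm₂).trans ?_
    have : 0 ≤ (q₁.divisors.card : ℝ) * ‖kappa2bar c' D m₂‖ * ((m₂ : ℝ) / m₂.totient) ^ 2 := by positivity
    calc CM₀ * (q₁.divisors.card : ℝ) * ‖kappa2bar c' D m₂‖ * ((m₂ : ℝ) / m₂.totient) ^ 2
        = CM₀ * ((q₁.divisors.card : ℝ) * ‖kappa2bar c' D m₂‖ * ((m₂ : ℝ) / m₂.totient) ^ 2) := by ring
      _ ≤ CM * ((q₁.divisors.card : ℝ) * ‖kappa2bar c' D m₂‖ * ((m₂ : ℝ) / m₂.totient) ^ 2) :=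
          mul_le_mul_of_nonneg_right hCMge this
      _ = _ := by ring
  -- the count with the nonnegative constant
  have hA0 : 0 ≤ frakA χ := frakA_nonneg χ
  have hG0 : 0 ≤ Real.log (ell D) := Real.log_nonneg hℓ1
  have hcnt : ∑ l ∈ Finset.Ico 1 (D ^ 4), ‖nu χ l‖ * tau 6 l / l ≤
      CA' * (frakA χ + 1) ^ 3 * Real.log (ell D) ^ 6 := by
    refine (hD₁ D χ hD1 hq hp hA).trans ?_
    have hA1 : 0 ≤ (frakA χ + 1) ^ 3 * Real.log (ell D) ^ 6 := by positivity
    rw [mul_assoc, mul_assoc]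
    exact mul_le_mul_of_nonneg_right hCAge hA1
  -- sizes
  have hα : alpha D = π / ell D ^ 9 := by rw [alpha, bigP, Real.log_exp]
  have hb : |b1 c' D| ≤ Kb / ell D ^ 9 := by
    have := U007.abs_b1_le c' hlog1
    rw [hα] at this
    calc |b1 c' D| ≤ (1 + 5 * |c'| * π) * (π / ell D ^ 9) := this
      _ = Kb / ell D ^ 9 := by rw [hKb]; ring
  have hN2 : Real.log (⌈4 * ((D : ℝ) ^ 4 + 1) * bigT D ^ 4⌉₊ : ℕ) + Real.log 4 ≤ 13 * ell D ^ 2 :=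
    log_N2_add_log_four_le (D := D) hℓ1
  -- `Y = KY / 𝓛⁷ ≤ 1`
  have hYeq : 4 * C4 * (Kb / ell D ^ 9) * (13 * ell D ^ 2) = KY / ell D ^ 7 := by
    have h97 : ell D ^ 9 = ell D ^ 7 * ell D ^ 2 := by ring
    rw [hKY, h97]; field_simp
  have hℓ7 : ell D ≤ ell D ^ 7 := le_self_pow₀ hℓ1 (by norm_num)
  have hY0 : 0 ≤ KY / ell D ^ 7 := by positivity
  have hY1 : KY / ell D ^ 7 ≤ 1 := by
    rw [div_le_one (by positivity)]; linarith
  -- `Y (e^Y − 1) ≤ 2 Y² ≤ 2 KY² / 𝓛⁹`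
  have hOm : (KY / ell D ^ 7) * (Real.exp (KY / ell D ^ 7) - 1) ≤ 2 * KY ^ 2 / ell D ^ 9 := by
    refine (mul_exp_sub_one_le' hY0 hY1).trans ?_
    have h4 : (KY / ell D ^ 7) ^ 2 ≤ KY ^ 2 / ell D ^ 9 := by
      rw [div_pow, ← pow_mul]
      refine div_le_div_of_nonneg_left (sq_nonneg _) (by positivity) ?_
      exact pow_le_pow_right₀ hℓ1 (by norm_num)
    calc 2 * (KY / ell D ^ 7) ^ 2 ≤ 2 * (KY ^ 2 / ell D ^ 9) := by linarith
      _ = 2 * KY ^ 2 / ell D ^ 9 := by ring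
  -- the prime-power part `≤ KP / 𝓛⁹`
  have hPi : 8 * C4' * C5 * (Kb / ell D ^ 9) = KP / ell D ^ 9 := by rw [hKP]; ring
  have hW : (4 * C4 * (Kb / ell D ^ 9) * (13 * ell D ^ 2)) *
        (Real.exp (4 * C4 * (Kb / ell D ^ 9) * (13 * ell D ^ 2)) - 1) +
      8 * C4' * C5 * (Kb / ell D ^ 9) ≤ (2 * KY ^ 2 + KP) / ell D ^ 9 := by
    rw [hYeq, hPi, add_div]; exact add_le_add hOm le_rfl
  have hW0 : 0 ≤ (4 * C4 * (Kb / ell D ^ 9) * (13 * ell D ^ 2)) *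
        (Real.exp (4 * C4 * (Kb / ell D ^ 9) * (13 * ell D ^ 2)) - 1) +
      8 * C4' * C5 * (Kb / ell D ^ 9) := by
    rw [hYeq, hPi]
    exact add_nonneg (mul_nonneg hY0 (by have := Real.one_le_exp hY0; linarith))
      (div_nonneg hKP0 (by positivity))
  -- `𝔞 + 1 ≤ KA 𝓛⁴`
  have hA4 : frakA χ + 1 ≤ KA * ell D ^ 4 := by
    have h := frakA_le_ell_pow_four' χ hℓ3 hp
    have h1 : (1 : ℝ) ≤ ell D ^ 4 := one_le_pow₀ hℓ1
    have e : KA * ell D ^ 4 = 16 * Real.exp 9 * ell D ^ 4 + ell D ^ 4 := by rw [hKA]; ring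
    rw [e]; linarith
  have hcount' : ∑ l ∈ Finset.Ico 1 (D ^ 4), ‖nu χ l‖ * tau 6 l / l ≤
      CA' * (KA ^ 2 * ell D ^ 8 * Real.log (ell D) ^ 6) * (frakA χ + 1) := by
    refine hcnt.trans ?_
    have h2 : (frakA χ + 1) ^ 2 ≤ (KA * ell D ^ 4) ^ 2 := pow_le_pow_left₀ (by linarith) hA4 2
    have hA10 : 0 ≤ frakA χ + 1 := by linarith
    have key : (frakA χ + 1) ^ 3 * Real.log (ell D) ^ 6 ≤
        KA ^ 2 * ell D ^ 8 * Real.log (ell D) ^ 6 * (frakA χ + 1) := by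
      calc (frakA χ + 1) ^ 3 * Real.log (ell D) ^ 6
          = (frakA χ + 1) ^ 2 * (Real.log (ell D) ^ 6 * (frakA χ + 1)) := by ring
        _ ≤ (KA * ell D ^ 4) ^ 2 * (Real.log (ell D) ^ 6 * (frakA χ + 1)) :=
            mul_le_mul_of_nonneg_right h2 (by positivity)
        _ = KA ^ 2 * ell D ^ 8 * Real.log (ell D) ^ 6 * (frakA χ + 1) := by ring
    calc CA' * (frakA χ + 1) ^ 3 * Real.log (ell D) ^ 6
        = CA' * ((frakA χ + 1) ^ 3 * Real.log (ell D) ^ 6) := by ring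
      _ ≤ CA' * (KA ^ 2 * ell D ^ 8 * Real.log (ell D) ^ 6 * (frakA χ + 1)) :=
          mul_le_mul_of_nonneg_left key hCA'0
      _ = _ := by ring
  have hS0 : 0 ≤ ∑ l ∈ Finset.Ico 1 (D ^ 4), ‖nu χ l‖ * tau 6 l / l :=
    Finset.sum_nonneg fun l _ => div_nonneg (mul_nonneg (norm_nonneg _) (tau_nonneg 6 l)) (Nat.cast_nonneg l)
  have heq : CM * ((2 * KY ^ 2 + KP) / ell D ^ 9) *
      (CA' * (KA ^ 2 * ell D ^ 8 * Real.log (ell D) ^ 6) * (frakA χ + 1)) =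
      (K * Real.log (ell D) ^ 6 / ell D) * (frakA χ + 1) := by
    rw [hK]; field_simp
  -- `(log 𝓛)⁶ ≤ 12⁶ 𝓛^{1/2}`, so `K (log 𝓛)⁶/𝓛 ≤ K·12⁶/𝓛^{1/2} ≤ ε`
  have hsq : Real.sqrt (ell D) * Real.sqrt (ell D) = ell D := Real.mul_self_sqrt hℓ0.le
  have hsq0 : 0 < Real.sqrt (ell D) := Real.sqrt_pos.mpr hℓ0
  have hlg : Real.log (ell D) ≤ 12 * (ell D) ^ (1 / 12 : ℝ) := by
    have := Real.log_le_rpow_div hℓ0.le (by norm_num : (0 : ℝ) < 1 / 12)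
    linarith [show (ell D) ^ (1 / 12 : ℝ) / (1 / 12) = 12 * (ell D) ^ (1 / 12 : ℝ) by ring]
  have hG6 : Real.log (ell D) ^ 6 ≤ 12 ^ 6 * Real.sqrt (ell D) := by
    have h1 : Real.log (ell D) ^ 6 ≤ (12 * (ell D) ^ (1 / 12 : ℝ)) ^ 6 := pow_le_pow_left₀ hG0 hlg 6
    have h2 : ((ell D) ^ (1 / 12 : ℝ)) ^ 6 = Real.sqrt (ell D) := by
      rw [← Real.rpow_natCast, ← Real.rpow_mul hℓ0.le, Real.sqrt_eq_rpow]; norm_num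
    rw [mul_pow, h2] at h1; exact h1
  have hfin : K * Real.log (ell D) ^ 6 / ell D ≤ ε := by
    rw [div_le_iff₀ hℓ0]
    have hM : (K * 12 ^ 6 / ε) ^ 2 ≤ ell D := by linarith
    -- `K 12⁶/ε ≤ √𝓛`
    have hM0 : 0 ≤ K * 12 ^ 6 / ε := by positivity
    have hroot : K * 12 ^ 6 / ε ≤ Real.sqrt (ell D) := by
      rw [← Real.sqrt_sq hM0]; exact Real.sqrt_le_sqrt hM
    have h3 : K * 12 ^ 6 ≤ ε * Real.sqrt (ell D) := by
      rw [div_le_iff₀ hε] at hroot; linarith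
    calc K * Real.log (ell D) ^ 6 ≤ K * (12 ^ 6 * Real.sqrt (ell D)) := mul_le_mul_of_nonneg_left hG6 hK0
      _ = (K * 12 ^ 6) * Real.sqrt (ell D) := by ring
      _ ≤ (ε * Real.sqrt (ell D)) * Real.sqrt (ell D) := mul_le_mul_of_nonneg_right h3 hsq0.le
      _ = ε * ell D := by rw [mul_assoc, hsq]
  -- the deterministic bound (introduced last: it is a large term, kept away from `linarith`)
  have hmain := outer_composite_le c' χ hℓ3 hCM0 hM1 hC4 hC4' hC5 hb hN2
    (fun a b m => (D : ℝ) ^ 4 < b * m ∧ 2 ≤ m ∧ ¬ m.Prime ∧ Nat.Coprime m a)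
    (fun a b m h => ⟨h.2.1, h.2.2.1⟩)
  refine hmain.trans ?_
  calc CM * ((4 * C4 * (Kb / ell D ^ 9) * (13 * ell D ^ 2)) *
          (Real.exp (4 * C4 * (Kb / ell D ^ 9) * (13 * ell D ^ 2)) - 1) + 8 * C4' * C5 * (Kb / ell D ^ 9)) *
          ∑ l ∈ Finset.Ico 1 (D ^ 4), ‖nu χ l‖ * tau 6 l / l
      ≤ CM * ((2 * KY ^ 2 + KP) / ell D ^ 9) *
          (CA' * (KA ^ 2 * ell D ^ 8 * Real.log (ell D) ^ 6) * (frakA χ + 1)) :=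
        mul_le_mul (mul_le_mul_of_nonneg_left hW hCM0) hcount' hS0
          (mul_nonneg hCM0 (div_nonneg (by positivity) (by positivity)))
    _ = (K * Real.log (ell D) ^ 6 / ell D) * (frakA χ + 1) := heq
    _ ≤ ε * (frakA χ + 1) := mul_le_mul_of_nonneg_right hfin (by linarith)


/-- **M2L-c CLOSED — the composite large-argument range of `R₁` is `o(𝔞+1)`, with no hypothesis left**
(the `hLc` input of `Phi3Eval.step17_u021Chi_R1Rel_of_split_rel`): the previous theorem with the count of
record `Typed.Section17.sum_nu_tau6_div_le_frakA_cube_loglog` (A1b, zl-libB-p6 / zl-libB-typer).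
[cite: Zhang2022LandauSiegel, §17 u021 p. 98] -/
theorem R1_composite_large_small :
    ∀ ε : ℝ, 0 < ε → ForAllLarge fun D _ χ => AssumptionA D χ →
      ∑ l ∈ Finset.Ico 1 (D ^ 4), ‖nu χ l‖ / l * ∑ q ∈ l.divisorsAntidiagonal, ∑' m₁ : ℕ, ∑' m₂ : ℕ,
        (if (D : ℝ) ^ 4 < q.2 * m₂ ∧ 2 ≤ m₂ ∧ ¬ m₂.Prime ∧ Nat.Coprime m₂ q.1 then
          ‖bcoef D (q.1 * m₁)‖ * ‖nuOneStar c' χ (q.2 * m₂)‖ * ‖kappa2bar c' D (m₁ * m₂)‖ /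
            ((m₁ : ℝ) * m₂) else 0) ≤ ε * (frakA χ + 1) :=
  R1_composite_large_small_of_count_loglog c' sum_nu_tau6_div_le_frakA_cube_loglog

end Closed

end Literature.NumberTheory.LFunctions.Zhang2022.Typed.Section17
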